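import Literature.MathematicalPhysics.QuantumFieldTheory.LatticeYangMillsClusteringTransfer
import Literature.MathematicalPhysics.QuantumFieldTheory.SUNBakryEmeryFrame
import HarnessLib

/-!
# Uniform log-Sobolev inequalities for the DLR kernels of `SU(N)` lattice Yang–Mills:
# the Bakry–Émery criterion with boundary conditions, and Stroock–Zegarlinski uniqueness

Two printed theorems, typed for the Wilson specification `γ_E(· | η) = ymSpecification ρ (Nβ) E η`
(`SU(N)`, 't Hooft scaling, finite edge set `E ⊂ ℤ^d`, exterior configuration `η`), with the
log-Sobolev inequality in GRADIENT form as the common currency: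

1. **Bakry–Émery criterion** (Bakry–Émery 1985; Bakry–Gentil–Ledoux 2014, Prop. 5.7.1; F.-Y. Wang
   2006, Thm. 5.6.1; used verbatim by Shen–Zhu–Zhu, CMP 400 (2023), Theorem 4.2 / Cor. 4.4 for the
   TORUS measures and, by their Remark 1.3, for other boundary conditions): on a compact Riemannian
   manifold, a probability measure `μ = Z⁻¹ e^{-W} dvol` with `Ric + Hess W ≥ K > 0` satisfies
   `Ent_μ(f²) ≤ (2/K) ∫ |∇f|² dμ`. Instance typed here (`bakryEmery_kernelLogSobolev`): the manifold
   is `SU(N)^E` with the product of the Hilbert–Schmidt bi-invariant metrics (`Ric = N/2` on each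
   factor, SZZ (4.8) / [AGZ10, (F.6)]), `W = -Nβ Σ_{p ∩ E ≠ ∅} Re tr hol_p(· ∨ η)` is the potential
   of the kernel `γ_E(· | η)` (`wilsonBoundaryAction`, `plaquettesTouching`), and the Hessian input
   is a parameter `Λ₀`: IF `|d²/dt²|₀ Σ_{p ∩ E ≠ ∅} Re tr hol_p(e^{tX}U)| ≤ Λ₀ Σ_{e∈E} ‖X_e‖²` for
   all `E`, all `U` on `ℤ^d`, all `X ∈ 𝔰𝔲(N)^E` (`RegionWilsonHessianBound d N Λ₀` — the regional
   analogue of `WilsonHessianBound`), THEN for `K := N/2 - N|β|Λ₀ > 0` every kernel satisfies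
   `LSI(2/K)` in gradient form, uniformly in `E` and `η` (`UniformKernelLogSobolev d N β K`).
   The venture `Summits/Ventures/YMGap` proves `RegionWilsonHessianBound d N (4d)` (kernel-checked).
2. **Stroock–Zegarlinski** (CMP 144 (1992) 303–323, Theorem 1.2 with Theorem 3.2): for a finite-range,
   shift-invariant, `C²` lattice system on `ℤ^d` with spins in a compact connected Riemannian manifold
   `M`, the uniform log-Sobolev inequality (1.4) — `sup_{Λ finite, z} c(E_Λ(·|z); Λ) < ∞` for the
   local specification — implies the Dobrushin–Shlosman mixing condition (1.5), and (Theorem 3.2: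
   "Assume that (1.4) holds, let μ denote the unique element of 𝔊(𝒥)") the Gibbs state is unique.
   Lattice Yang–Mills fits this setting after bundling the `d` links leaving a site into one spin in
   `M = SU(N)^d` (range `1`, analytic shift-invariant potential); SZ's site-indexed kernels are the
   `γ_E` with `E` a union of outgoing stars, and every edge-DLR state (`ymGibbsMeasures`) is a Gibbs
   state of the site-indexed specification, so `|𝔊| = 1` gives `(ymGibbsMeasures …).Subsingleton`
   (`stroockZegarlinski_uniqueness`; existence is a tree theorem and is not part of the fact).

The gradient `|∇_e F|²` of a cylinder function `F = f((U_e)_{e∈E})` in the link `e` is rendered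
concretely through the Parseval frame `(Y_α)` of `𝔰𝔲(N)` of `SUNBakryEmeryFrame`
(`∑_α ⟨Y_α, X⟩² = ‖X‖²` on `𝔰𝔲(N)`, `sum_sq_re_trace_frame_mul`): `|∇_e F|²(U) =
∑_α (d/dt|₀ f(…, e^{tY_α}U_e, …))²` (`linkGradSq`), which is SZZ's `Σ_i |v_e^i F|²` over an
orthonormal basis ((1.8), §4.3) since a Parseval frame gives the same sum of squares.

Not here: proofs of 1 and 2 (the Bakry–Émery `Γ₂` argument on `SU(N)^E` is in the tree only for ONE
link, `SUNBakryEmery.haarPoincare_SU`; the Stroock–Zegarlinski/Glauber-dynamics argument is not in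
the tree); the `SO(N)` case; the clustering half (sibling file `LatticeYangMillsClusteringTransfer`).
-- TODO(general form): 1 = the Bakry–Émery criterion on an arbitrary compact Riemannian manifold
--   (BGL14 Prop. 5.7.1); 2 = SZ92 Thm 1.2 for an arbitrary compact connected spin manifold and
--   finite-range C² potential (here only the `SU(N)` Wilson specification).

## References

* D. Bakry, M. Émery, *Diffusions hypercontractives*, LNM 1123 (1985) 177–206 [BakryEmery1985].
* D. Bakry, I. Gentil, M. Ledoux, Grundlehren 348 (2014), Prop. 5.7.1 [BakryGentilLedoux2014].
* D. W. Stroock, B. Zegarlinski, CMP 144 (1992) 303–323: setting p. 305–307, (1.1) p. 307,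
  Theorem 1.2 with (1.3)–(1.5) p. 307–308, Remark 1.6–1.7 p. 308–309, Theorem 3.2 p. 315
  [StroockZegarlinski1992Equivalence].
* H. Shen, R. Zhu, X. Zhu, CMP 400 (2023) 805–851: (1.8), Remark 1.3, Lemma 4.1, Theorem 4.2,
  (4.7)–(4.8), Cor. 4.4 (4.11)–(4.12) [ShenZhuZhuCMP2023].
-/

noncomputable section

open MeasureTheory ProbabilityTheory NormedSpace
open scoped Matrix
open Literature.MathematicalPhysics.QuantumLattice

namespace Literature.MathematicalPhysics.QuantumFieldTheory

variable {d N : ℕ}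

/-! ### The regional Hessian hypothesis (shape of SZZ Lemma 4.1 for a kernel with boundary condition) -/

/-- The regional Wilson plaquette sum along the exponential curve through `U` with velocity `XU`:
`t ↦ Σ_{p ∩ E ≠ ∅} Re Tr((e^{tX₁}U₁)(e^{tX₂}U₂)(e^{tX₃}U₃)^*(e^{tX₄}U₄)^*)` over the plaquettes of
`ℤ^d` touching the finite edge set `E` (`plaquettesTouching E`, the plaquettes of the DLR kernel of
`E`; links of `p = (x; i<j)` in the order of `plaquetteHolonomyZd`). At `t = 0` and for `X`
supported on `E` this is the `U_E`-dependent part of `-wilsonBoundaryAction` (up to the constant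
`N·#plaquettes`), i.e. `Nβ ·` (this) is the potential of `γ_E(· | U_{Eᶜ})` at tree coupling `Nβ`.
[cite: ShenZhuZhuCMP2023, (4.3)] -/
def regionPlaquetteSumAlong (E : Finset (ZdEdge d))
    (U : LGConfig d (Matrix.specialUnitaryGroup (Fin N) ℂ))
    (X : ZdEdge d → Matrix (Fin N) (Fin N) ℂ) (t : ℝ) : ℝ :=
  ∑ p ∈ plaquettesTouching E,
    (exp (t • X (p.1, p.2.1.1)) * (U (p.1, p.2.1.1) : Matrix (Fin N) (Fin N) ℂ)
      * (exp (t • X (p.1 + Pi.single p.2.1.1 1, p.2.1.2))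
          * (U (p.1 + Pi.single p.2.1.1 1, p.2.1.2) : Matrix (Fin N) (Fin N) ℂ))
      * (exp (t • X (p.1 + Pi.single p.2.1.2 1, p.2.1.1))
          * (U (p.1 + Pi.single p.2.1.2 1, p.2.1.1) : Matrix (Fin N) (Fin N) ℂ))ᴴ
      * (exp (t • X (p.1, p.2.1.2)) * (U (p.1, p.2.1.2) : Matrix (Fin N) (Fin N) ℂ))ᴴ).trace.re

variable (d N) in
/-- **Regional Hessian bound with constant `Λ₀`** (the shape of Shen–Zhu–Zhu's Lemma 4.1 for the
potential of a DLR kernel with frozen exterior, cf. their Remark 1.3): for every finite edge set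
`E ⊂ ℤ^d`, every configuration `U ∈ SU(N)^{edges of ℤ^d}` (interior and exterior) and every
`X ∈ 𝔰𝔲(N)^{edges}` vanishing off `E`,
`|d²/dt²|_{t=0} Σ_{p ∩ E ≠ ∅} Re Tr hol_p(e^{tX}U)| ≤ Λ₀ Σ_{e∈E} Tr(X_eX_e^*)`, i.e.
`|Hess_{S_E}(v,v)| ≤ Λ₀ N|β| |v|²` for the kernel potential `S_E = Nβ Σ_{p∩E≠∅} Re Tr Q_p` on
`SU(N)^E`. SZZ's termwise count gives `Λ₀ = 8(d-1)` here as on the torus; the venture proves `4d`.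
[cite: ShenZhuZhuCMP2023, Lemma 4.1] -/
def RegionWilsonHessianBound (Λ₀ : ℝ) : Prop :=
  ∀ (E : Finset (ZdEdge d)) (U : LGConfig d (Matrix.specialUnitaryGroup (Fin N) ℂ))
    (X : ZdEdge d → Matrix (Fin N) (Fin N) ℂ),
    (∀ e, (X e)ᴴ = -X e) → (∀ e, (X e).trace = 0) → (∀ e ∉ E, X e = 0) →
      |iteratedDeriv 2 (regionPlaquetteSumAlong E U X) 0| ≤ Λ₀ * ∑ e ∈ E, (X e * (X e)ᴴ).trace.re

/-- Monotonicity of the regional Hessian hypothesis in the constant.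
[cite: ShenZhuZhuCMP2023, Lemma 4.1] -/
theorem RegionWilsonHessianBound.mono {Λ₀ Λ₁ : ℝ} (h : RegionWilsonHessianBound d N Λ₀)
    (hle : Λ₀ ≤ Λ₁) : RegionWilsonHessianBound d N Λ₁ := by
  intro E U X hX hX0 hXE
  refine (h E U X hX hX0 hXE).trans (mul_le_mul_of_nonneg_right hle ?_)
  refine Finset.sum_nonneg fun e _ => ?_
  rw [Matrix.trace, Complex.re_sum]
  refine Finset.sum_nonneg fun i _ => ?_
  rw [Matrix.diag_apply, Matrix.mul_apply, Complex.re_sum]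
  refine Finset.sum_nonneg fun j _ => ?_
  rw [Matrix.conjTranspose_apply, Complex.star_def, Complex.mul_conj, Complex.ofReal_re]
  exact Complex.normSq_nonneg _

/-! ### Gradient form of the log-Sobolev inequality for a kernel -/

-- From here on the Frobenius norm on matrices is in scope (as in `ShenZhuZhuLogSobolev`), for
-- `ContDiff` of cylinder functions.
open scoped Matrix.Norms.Frobenius ContDiff

/-- The squared link gradient `|∇_e F|²` of the cylinder function `F = f((U_e)_{e∈E})` in the link
`e ∈ E`, at the link matrices `M`: `∑_α (d/dt|_{t=0} f(M with M_e ↦ e^{tY_α} M_e))²` over the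
Parseval frame `(Y_α)` of `𝔰𝔲(N)` (`SUNBakryEmery.frame`; Hilbert–Schmidt metric
`⟨X,Y⟩ = Re Tr(XY^*)`). For `M ∈ SU(N)^E` and differentiable `f` this is Shen–Zhu–Zhu's
`|∇_e F|² = Σ_i |v_e^i F|²` over an orthonormal basis `{v_e^i}` of right-invariant vector fields
(§2 p. 10–11, (1.8), §4.3 p. 25), a Parseval frame giving the same sum of squares as an
orthonormal basis. [cite: ShenZhuZhuCMP2023, (1.8)] -/
def linkGradSq (E : Finset (ZdEdge d)) (f : (↥E → Matrix (Fin N) (Fin N) ℂ) → ℝ) (e : ↥E)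
    (M : ↥E → Matrix (Fin N) (Fin N) ℂ) : ℝ :=
  ∑ α : SUNBakryEmery.FrameIdx N,
    (deriv (fun t : ℝ => f (Function.update M e (exp (t • SUNBakryEmery.frame α) * M e))) 0) ^ 2

variable (d N) in
/-- **Log-Sobolev inequality, gradient form, for ONE kernel.** `KernelLogSobolev d N β K E η`: the
DLR kernel `γ = γ_E(· | η)` of the `SU(N)` Wilson specification at tree coupling `Nβ`
(`ymSpecification (fundamentalRep (Fin N)) (Nβ) E η`) satisfies, for every `C¹` function `f` of the
link matrices over `E` and `F = f((U_e)_{e∈E})` (`matrixCylinder E f`),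
`Ent_γ(F²) := γ(F² log F²) - γ(F²) log γ(F²) ≤ (2/K) Σ_{e∈E} ∫ |∇_e F|² dγ` — Shen–Zhu–Zhu's
(4.11)/(4.12) shape `μ(F² log F²) ≤ (2/K_S) ℰ(F,F)` (for `μ(F²) = 1`; homogeneous form by scaling),
Stroock–Zegarlinski's (1.1) with `c = 1/K`. Since `γ_E(· | η)` is carried by configurations equal
to `η` off `E`, functions of all links reduce to such cylinder functions under `γ`.
[cite: ShenZhuZhuCMP2023, Corollary 4.4] -/
def KernelLogSobolev (β K : ℝ) (E : Finset (ZdEdge d))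
    (η : LGConfig d (Matrix.specialUnitaryGroup (Fin N) ℂ)) : Prop :=
  ∀ (f : (↥E → Matrix (Fin N) (Fin N) ℂ) → ℝ), ContDiff ℝ 1 f →
    ∫ U, matrixCylinder E f U ^ 2 * Real.log (matrixCylinder E f U ^ 2)
        ∂(ymSpecification (fundamentalRep (Fin N)) ((N : ℝ) * β) E η) -
      (∫ U, matrixCylinder E f U ^ 2 ∂(ymSpecification (fundamentalRep (Fin N)) ((N : ℝ) * β) E η)) *
        Real.log (∫ U, matrixCylinder E f U ^ 2
          ∂(ymSpecification (fundamentalRep (Fin N)) ((N : ℝ) * β) E η))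
      ≤ 2 / K * ∑ e : ↥E, ∫ U, linkGradSq E f e (fun e' => (U e' : Matrix (Fin N) (Fin N) ℂ))
          ∂(ymSpecification (fundamentalRep (Fin N)) ((N : ℝ) * β) E η)

variable (d N) in
/-- **Uniform log-Sobolev inequality for the kernels** (Stroock–Zegarlinski's hypothesis (1.4),
`sup_{Λ,z} c(E_Λ(·|z); Λ) < ∞`, with the explicit constant `c = 1/K`): `KernelLogSobolev` for EVERY
finite edge set `E` and EVERY exterior configuration `η`, with one constant `K`.
[cite: StroockZegarlinski1992Equivalence, (1.4)] -/
def UniformKernelLogSobolev (β K : ℝ) : Prop :=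
  ∀ (E : Finset (ZdEdge d)) (η : LGConfig d (Matrix.specialUnitaryGroup (Fin N) ℂ)),
    KernelLogSobolev d N β K E η

/-! ### Named fact 1: the Bakry–Émery criterion for the kernels, Hessian constant as a parameter -/

variable (d N) in
/-- **Bakry–Émery criterion for the DLR kernels of `SU(N)` lattice Yang–Mills** (Bakry–Émery 1985;
Bakry–Gentil–Ledoux 2014 Prop. 5.7.1: on a compact Riemannian manifold, `μ ∝ e^{-W} dvol` with
`Ric + Hess W ≥ K > 0` satisfies `Ent_μ(f²) ≤ (2/K) ∫|∇f|² dμ`; the torus instance is Shen–Zhu–Zhu's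
Theorem 4.2 / Cor. 4.4, (4.7)–(4.8), (4.11)–(4.12), and their Remark 1.3 notes that other boundary
conditions are treated identically). On `SU(N)^E` with the Hilbert–Schmidt bi-invariant product
metric, `Ric(v,v) = (N/2)|v|²` ((4.8), `N ≥ 2`); the kernel `γ_E(· | η)` at tree coupling `Nβ` has
density `∝ exp(Nβ Σ_{p∩E≠∅} Re Tr Q_p)` with respect to Haar (= normalised Riemannian) measure; so
if `|Hess(Σ_{p∩E≠∅} Re Tr Q_p)(v,v)| ≤ Λ₀|v|²` uniformly (`RegionWilsonHessianBound d N Λ₀`), then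
`Ric + Hess W ≥ K := N/2 - N|β|Λ₀`, and for `K > 0` every kernel satisfies the log-Sobolev inequality
with constant `2/K` in gradient form, uniformly in `E` and `η`: `UniformKernelLogSobolev d N β K`.
[cite: BakryGentilLedoux2014, Proposition 5.7.1] -/
def bakryEmery_kernelLogSobolev : Prop :=
  ∀ (Λ₀ : ℝ), 0 ≤ Λ₀ → RegionWilsonHessianBound d N Λ₀ →
    ∀ (_ : 2 ≤ N) (β : ℝ), 0 < (N : ℝ) / 2 - N * |β| * Λ₀ →
      UniformKernelLogSobolev d N β ((N : ℝ) / 2 - N * |β| * Λ₀)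

/-! ### Named fact 2: Stroock–Zegarlinski, uniform log-Sobolev implies uniqueness -/

variable (d N) in
/-- **Stroock–Zegarlinski, uniform log-Sobolev inequality ⇒ uniqueness of the Gibbs state**
(CMP 144 (1992), Theorem 1.2: for a finite-range shift-invariant `C²` potential on `ℤ^d` with spins
in a compact connected Riemannian manifold `M`, the uniform log-Sobolev inequality (1.4) for the
local specification is equivalent to the Dobrushin–Shlosman mixing condition (1.5); Theorem 3.2:
"Assume that (1.4) holds, let `μ` denote the unique element of `𝔊(𝒥)` …"). Instance typed here:
`SU(N)` lattice Yang–Mills on `ℤ^d` at tree coupling `Nβ` — a range-one analytic shift-invariant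
system with site spin space `SU(N)^d` (the `d` links leaving a site), whose site-indexed local
specification consists of the Wilson kernels `γ_E(· | η)` for `E` a union of outgoing stars; the
hypothesis is taken in the (stronger) form "for ALL finite edge sets `E`"
(`UniformKernelLogSobolev d N β K`, `K > 0`, i.e. (1.4) with `c = 1/K`), and the conclusion in the
(weaker) form "the edge-DLR states `ymGibbsMeasures` — each of which is a Gibbs state of the
site-indexed specification — form a subsingleton". Existence of a DLR state is a tree theorem
(`infiniteVolumeLimitPoints_nonempty_holds`, `mem_ymGibbsMeasures_of_mem_infiniteVolumeLimitPoints_holds`)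
and is not part of this fact. [cite: StroockZegarlinski1992Equivalence, Theorem 1.2] -/
def stroockZegarlinski_uniqueness : Prop :=
  ∀ (_ : 2 ≤ d) (_ : 2 ≤ N) (β K : ℝ), 0 < K → UniformKernelLogSobolev d N β K →
    (ymGibbsMeasures (d := d) (fundamentalRep (Fin N)) ((N : ℝ) * β)).Subsingleton

/-! ### Bookkeeping -/

-- The window of fact 1 in terms of `β` (`N/2 - N|β|Λ₀ > 0 ↔ |β| < 1/(2Λ₀)`) is
-- `transferConst_pos_iff` of the sibling file `LatticeYangMillsClusteringTransfer`.

/-- **The two facts combined**: a regional Hessian bound `Λ₀` gives uniqueness of the DLR state for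
every `|β| < 1/(2Λ₀)` (`d, N ≥ 2`). With SZZ's termwise `Λ₀ = 8(d-1)` this is uniqueness in their
printed window `|β| < 1/(16(d-1))` (which the tree also proves by the Dobrushin route,
`shen_zhu_zhu_holds`); the venture feeds `Λ₀ = 4d`. [cite: StroockZegarlinski1992Equivalence, Theorem 1.2] -/
theorem subsingleton_gibbs_of_regionHessianBound (h₁ : bakryEmery_kernelLogSobolev d N)
    (h₂ : stroockZegarlinski_uniqueness d N) (hd : 2 ≤ d) (hN : 2 ≤ N) {Λ₀ : ℝ} (hΛ : 0 ≤ Λ₀)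
    (hH : RegionWilsonHessianBound d N Λ₀) {β : ℝ} (hK : 0 < (N : ℝ) / 2 - N * |β| * Λ₀) :
    (ymGibbsMeasures (d := d) (fundamentalRep (Fin N)) ((N : ℝ) * β)).Subsingleton :=
  h₂ hd hN β _ hK (h₁ Λ₀ hΛ hH hN β hK)

end Literature.MathematicalPhysics.QuantumFieldTheory
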